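import Summits.BirchSwinnertonDyer.BirchSwinnertonDyer.Theorems.EdixhovenFibreFiveSevenStarredOptimalManinUnitFiveSevenLocalFormulaOrdinaryCellsOfCapstone
import Summits.BirchSwinnertonDyer.BirchSwinnertonDyer.Theorems.EdixhovenFibreFiveSevenStarredOptimalManinUnitFiveSevenOfOrdinaryLocalFormula
import Summits.BirchSwinnertonDyer.BirchSwinnertonDyer.Theorems.EdixhovenFibreFiveSevenStarredOptimalManinUnitFiveSevenDokchitserDokchitser
import HarnessLib

/-!
# K★ `StarredOptimalManinUnitFiveSeven` ⟸ {P1-bar, THE ORDINARY CAPSTONE SOCKET} — conditional closer BY NAME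
# (route `EdixhovenFibreFiveSeven`, crux K★ stmt-BirchSwinnertonDyer-22226, line `kato-lever`; seat `bsd-line-edix-p4` g29, width)

HONEST FRAMING. One theorem (no definition, no named fact, no instance, no `sorry`), a CONDITIONAL closer (helper, `--supports 22226`): the crux K★ stays OPEN; BSD is
not proved by any of this. Composition of the LEAD's `…OfOrdinaryLocalFormula.starredOptimalManinUnitFiveSeven_of_ordinaryLocalFormula : LOC@ord → DD → P1-bar → K★`
(g30) with `…LocalFormulaOrdinaryCellsOfCapstone.localFormulaOrdinaryCells_of_capstone` (this seat: `stub_localFormulaOrdinaryCells` GRANTED the ordinary capstone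
socket `hcap`) and the landed stub DD (`…DokchitserDokchitser.stub_dokchitserDokchitser`, p793225): **K★ ⟸ {`hCAP`, P1-bar}**, where `hCAP` is the universal
closure over the stub's binders of the socket `hcap` — Kato's explicit reciprocity law at the points of `W′(K_{v′})` over deep FORMAL points of the good ordinary
`𝒪_D`-model of a (G)-ordinary K★ cell, in transport form (E3's output shape with `hker ∀ n`), for the model / CM-fibre / socket data handed over (see the docstring of
`localFormulaOrdinaryCells_of_capstone`) — exactly what the unit-root frame of memo `Cruxes/…/Lines/kato-lever-seam-rec-at-cells.md` §17 (bricks B3 + ordinary E3) is to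
deliver — and P1-bar = `Kato2004.exists_member_sl2ZetaElement_neron_values_bar` (print XL).

References: [Kato2004Asterisque] (8.1.3), Thm. 9.7, Thm. 6.6 (1); [Kato1993LNM1553] Ch. II Thm. 1.4.1 (3)–(4); [DokchitserDokchitser2015LocalInvariants] Thm. 5.1 (1).
-/

set_option autoImplicit false
-- single-conjunct summit: `Summit.BirchSwinnertonDyer.BirchSwinnertonDyer.…` repeats the name by design
set_option linter.dupNamespace false

noncomputable section

open Field Function ValuativeRel WittVector NumberField IsDedekindDomain Polynomial
open scoped NumberField Topology Classical NNReal
open Literature.NumberTheory.PAdicHodge Literature.NumberTheory.GaloisRepresentations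
  Literature.NumberTheory.GaloisRepresentations.IsNonarchimedeanLocalField Literature.NumberTheory.GaloisRepresentations.LubinTate
  Literature.NumberTheory.GaloisCohomology Literature.NumberTheory.EllipticCurves Literature.NumberTheory.EllipticCurves.FormalGroupChart
  Literature.NumberTheory.PAdicHodge.GaloisContinuity Literature.IUT.LogVolume Literature.RingTheory.FormalGroups
  Literature.AlgebraicGeometry.Resolution _root_.WeierstrassCurve
  Literature.NumberTheory.EllipticCurves.Rank1Residual Literature.NumberTheory.DiophantineGeometry Rat.HeightOneSpectrum
  Literature.NumberTheory.EllipticCurves.Kato2004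
  Summit.BirchSwinnertonDyer.Rank1Residual Summit.BirchSwinnertonDyer.Rank1Residual.Additive
  Summit.BirchSwinnertonDyer.BirchSwinnertonDyer.Theorems

namespace Summit.BirchSwinnertonDyer.BirchSwinnertonDyer.Theorems.StarredOptimalManinUnitFiveSevenOfOrdinaryCapstone

set_option maxHeartbeats 1600000 in
/-- ★★★ **K★ ⟸ {ordinary capstone socket, P1-bar}, BY NAME.** `hCAP`: for every curve and datum as in the stub `stub_localFormulaOrdinaryCells` (its binders verbatim)
the ordinary capstone socket `hcap` of `localFormulaOrdinaryCells_of_capstone` (Kato's formula at the points over deep formal points of the good ordinary model, transport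
form); `hP1`: Kato's `SL₂(ℤ)`-type zeta-element values in the Néron coordinate (print). Then the crux `StarredOptimalManinUnitFiveSeven` (through the LEAD's
`starredOptimalManinUnitFiveSeven_of_ordinaryLocalFormula`, the landed DD stub and the landed supersingular stub inside it).
[cite: Kato2004Asterisque, (8.1.3) (p. 180), Thm. 9.7 (p. 189), Thm. 6.6 (1) (p. 163)] [cite: Kato1993LNM1553, Ch. II Thm. 1.4.1 (3)–(4)]
[cite: DokchitserDokchitser2015LocalInvariants, Thm. 5.1 (1)] -/
theorem starredOptimalManinUnitFiveSeven_of_ordinaryCapstone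
    (hCAP : ∀ (W : WeierstrassCurve ℚ) [W.IsElliptic] [W.IsGloballyMinimal] (p : ℕ) [Fact p.Prime]
    (hp57 : p = 5 ∨ p = 7) (hadd : Addv W p)
    (hIstar : ∀ (v : HeightOneSpectrum ℤ) (n : ℕ), natGenerator v = p → W.kodairaSymbolAt v ≠ KodairaSymbol.Istar n)
    (h4 : 4 < padicValInt p W.minimalDiscriminantInt) (_h9 : p = 5 ↔ padicValInt p W.minimalDiscriminantInt = 9)
    {K : Type} [Field K] [NumberField K] (α : K) {e : ℕ}
    (htab : p = 5 ∧ padicValInt p W.minimalDiscriminantInt = 9 ∧ e = 4 ∨ p = 7 ∧ padicValInt p W.minimalDiscriminantInt = 8 ∧ e = 3 ∨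
      p = 7 ∧ padicValInt p W.minimalDiscriminantInt = 10 ∧ e = 6) (hαe : α ^ e = (p : K))
    (v' : HeightOneSpectrum (𝓞 K)) (hv' : ((p : ℕ) : 𝓞 K) ∈ v'.asIdeal)
    [CharZero (v'.adicCompletion K)] [Fact (¬ IsUnit ((p : ℕ) : integerC (v'.adicCompletion K)))]
    [IsAdicComplete (Ideal.span {((p : ℕ) : integerC (v'.adicCompletion K))}) (integerC (v'.adicCompletion K))]
    (hp' : valuation (v'.adicCompletion K) ((p : ℕ) : (v'.adicCompletion K)) < 1)
    (ω' : Valuation (v'.adicCompletion K) ℝ≥0) [ω'.Compatible] [(W.baseChange (v'.adicCompletion K)).IsIntegral ω'.integer]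
    (eT : (k : ℕ) → geomTorsion W ((p ^ k : ℕ) : ℤ) → geomTorsion W ((p ^ k : ℕ) : ℤ) → AlgebraicClosure ℚ) (hμ : ∀ k S T, eT k S T ^ (p ^ k) = 1)
    (hadd₁ : ∀ k S₁ S₂ T, eT k (S₁ + S₂) T = eT k S₁ T * eT k S₂ T) (hadd₂ : ∀ k S T₁ T₂, eT k S (T₁ + T₂) = eT k S T₁ * eT k S T₂)
    (hgal : ∀ k (σ : absoluteGaloisGroup ℚ) (S T : geomTorsion W ((p ^ k : ℕ) : ℤ)), σ • eT k S T = eT k (σ • S) (σ • T))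
    (hnondeg : ∀ k (T : geomTorsion W ((p ^ k : ℕ) : ℤ)), (∀ S, eT k S T = 1) → T = 0) (halt : ∀ k (S : geomTorsion W ((p ^ k : ℕ) : ℤ)), eT k S S = 1)
    (hcompat : ∀ k (S T : geomTorsion W ((p ^ (k + 1) : ℕ) : ℤ)),
      eT k (torsionMulHom W (p ^ (k + 1)) (p ^ k) p (pow_succ p k).symm S) (torsionMulHom W (p ^ (k + 1)) (p ^ k) p (pow_succ p k).symm T) = eT (k + 1) S T ^ p)
    (hinjK : letI := LocalField.adicCompletionPadicAlgebra v' p hv'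
      (bdRPeriodRingData (F := (v'.adicCompletion K)) (p := p) hp').CupLogInjective (logCyclotomic p) (restrictedRationalTateRep W (v'.adicCompletion K) p))
    (hdeK : letI := LocalField.adicCompletionPadicAlgebra v' p hv'
      ∀ z : contOneCocycles (restrictedRationalTateRep W (v'.adicCompletion K) p).toTopRep,
        (bdRPeriodRingData (F := (v'.adicCompletion K)) (p := p) hp').HasDualExp (logCyclotomic p) (restrictedRationalTateRep W (v'.adicCompletion K) p) fun σ => z.1 σ)
    (d'' : letI := LocalField.adicCompletionPadicAlgebra v' p hv'
      (bdRPeriodRingData (F := (v'.adicCompletion K)) (p := p) hp').FilZeroLine (restrictedRationalTateRep W (v'.adicCompletion K) p)),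
      (letI := LocalField.padicAlgebra (v'.adicCompletion K) p hp'
      haveI : CharZero (CompletedAlgClosure (v'.adicCompletion K)) :=
        charZero_of_injective_algebraMap (algebraMap (v'.adicCompletion K) (CompletedAlgClosure (v'.adicCompletion K))).injective
      ∀ (r₄ r₆ t₄ t₆ : ℕ), ((p = 5 → r₄ = 0 ∧ t₄ = 0 ∧ 0 < t₆) ∧ (p = 7 → r₆ = 0 ∧ t₆ = 0 ∧ 0 < t₄)) →
      ∀ (D : EisensteinRoot (v'.adicCompletion K) p hp') (_hD : D.poly = X ^ e - C (p : ℤ_[p])) (a b : ℤ)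
        (Wm : WeierstrassCurve (EisensteinRoot.CoeffDisc D)) (ψ₀ : EisensteinRoot.CoeffDisc D →+* LTCoeff (v'.adicCompletion K))
        (_hψ₀ : ∀ c, algebraMap (LTCoeff (v'.adicCompletion K)) (v'.adicCompletion K) (ψ₀ c) = EisensteinRoot.CoeffDisc.toF D c)
        (_hWm : Wm = ⟨0, 0, 0, algebraMap ℤ (EisensteinRoot.CoeffDisc D) a * EisensteinRoot.CoeffDisc.of D (AdjoinRoot.root D.poly) ^ r₄,
          algebraMap ℤ (EisensteinRoot.CoeffDisc D) b * EisensteinRoot.CoeffDisc.of D (AdjoinRoot.root D.poly) ^ r₆⟩)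
        (_hu : IsUnit (64 * (a : ℤ_[p]) ^ 3 * (p : ℤ_[p]) ^ t₄ + 432 * (b : ℤ_[p]) ^ 2 * (p : ℤ_[p]) ^ t₆))
        (_hΔ : IsUnit (Wm.map ψ₀).Δ) (_hA : ((Wm.map ψ₀).map (AinfTop.redCoeff (v'.adicCompletion K))).hasseCoeff p ≠ 0)
        (_h1 : IsUnit (algebraMap (LTCoeff (v'.adicCompletion K)) (CBall (v'.adicCompletion K)) (PowerSeries.coeff p ((Wm.map ψ₀).formalMul p))))
        [(AinfTop.curveFO (v'.adicCompletion K) (Wm.map ψ₀)).IsElliptic]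
        [(curveOver (CompletedAlgClosure (v'.adicCompletion K)) (Wm.map ψ₀)).IsElliptic]
        (E₀ : WeierstrassCurve ℤ) (_hE₀ : E₀ = ⟨0, 0, 0, if r₄ = 0 then a else 0, if r₆ = 0 then b else 0⟩)
        (_hWE : Wm.map (Ideal.Quotient.mk (Ideal.span {EisensteinRoot.CoeffDisc.of D (AdjoinRoot.root D.poly)})) =
          (E₀.map (algebraMap ℤ (EisensteinRoot.CoeffDisc D))).map (Ideal.Quotient.mk (Ideal.span {EisensteinRoot.CoeffDisc.of D (AdjoinRoot.root D.poly)})))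
        (_hΔ₀ : ¬ (p : ℤ) ∣ E₀.Δ) (_hA₀ : (E₀.map (Int.castRingHom (ZMod p))).hasseCoeff p ≠ 0)
        (_htr : ¬ (p : ℤ) ∣ HasseManin.tr (E₀.map (Int.castRingHom (ZMod p))))
        (_hnorm : ‖((HasseManin.tr (E₀.map (Int.castRingHom (ZMod p))) : ℤ) : ℤ_[p])‖ = 1)
        (_hsq : HasseManin.tr (E₀.map (Int.castRingHom (ZMod p))) ^ 2 < 4 * p)
        [(E₀.map (Int.castRingHom ℚ_[p])).IsElliptic] [(E₀.map (Int.castRingHom (ZMod p))).IsElliptic]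
        [(curveOver (CompletedAlgClosure (v'.adicCompletion K)) E₀).IsElliptic]
        -- socket data of `W` over `F`
        (ψ : C(absoluteGaloisGroup (v'.adicCompletion K), ℤ_[p])) (_hψ : ∀ σ τ, ψ (σ * τ) = ψ σ + ψ τ)
        (_hψlog : ∀ τ, (ψ τ : ℚ_[p]) = logCyclotomic (F := (v'.adicCompletion K)) p τ)
        (_heL : ∀ (c : ℤ_[p]) (S U : W.tateModule p),
          (weilContPairingPadic W (v'.adicCompletion K) p eT hμ hadd₁ hadd₂ hgal hcompat).toLin (c • S) U =
          twistHom (v'.adicCompletion K) p ((weilContPairingPadic W (v'.adicCompletion K) p eT hμ hadd₁ hadd₂ hgal hcompat).toLin S U) c)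
        (_healt : ∀ S : W.tateModule p, (weilContPairingPadic W (v'.adicCompletion K) p eT hμ hadd₁ hadd₂ hgal hcompat).toLin S S = 0)
        (_henondeg : ∀ S : W.tateModule p,
          (∀ U, (weilContPairingPadic W (v'.adicCompletion K) p eT hμ hadd₁ hadd₂ hgal hcompat).toLin S U = 0) → S = 0)
        (_hinj : (bdRPeriodRingData (F := (v'.adicCompletion K)) (p := p) hp').CupLogInjective (logCyclotomic p)
          (restrictedRationalTateRep W (v'.adicCompletion K) p))
        (_hde : ∀ η : contOneCocycles (restrictedTateRep W (v'.adicCompletion K) p).toTopRep,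
          (bdRPeriodRingData (F := (v'.adicCompletion K)) (p := p) hp').HasDualExp (logCyclotomic p)
            (restrictedRationalTateRep W (v'.adicCompletion K) p) fun σ => TateModule.toRational p (η.1 σ))
        (d : (bdRPeriodRingData (F := (v'.adicCompletion K)) (p := p) hp').FilZeroLine (restrictedRationalTateRep W (v'.adicCompletion K) p))
        -- a depth `N ≥ 1`, then: the transport isomorphism onto the model and its Tate-module map
        , ∃ N : ℕ, N ≠ 0 ∧
      ∀ (φ : geomPoints (W.baseChange (v'.adicCompletion K)) ≃+ (AinfTop.curveFO (v'.adicCompletion K) (Wm.map ψ₀)).geomPoints)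
        (_hφ : ∀ (σ : absoluteGaloisGroup (v'.adicCompletion K)) (P : geomPoints (W.baseChange (v'.adicCompletion K))), φ (σ • P) = σ • φ P)
        (Tφ : (W.baseChange (v'.adicCompletion K)).tateModule p ≃ₗ[ℤ_[p]] (AinfTop.curveFO (v'.adicCompletion K) (Wm.map ψ₀)).tateModule p)
        (_hTφ : ∀ (a : (W.baseChange (v'.adicCompletion K)).tateModule p) (n : ℕ), TateModule.proj p n (Tφ a) = φ (TateModule.proj p n a)),
      ∃ c : v'.adicCompletion K,
      ∀ (η : contOneCocycles (restrictedTateRep W (v'.adicCompletion K) p).toTopRep)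
        (P : (W.baseChange (v'.adicCompletion K)).toAffine.Point)
        (Q : ℕ → geomPoints (W.baseChange (v'.adicCompletion K)))
        (_hQ : ∀ n, p • Q (n + 1) = Q n)
        (_hQ0 : Q 0 = toGeomPoints (W.baseChange (v'.adicCompletion K)) P)
        (hker : ∀ n, AinfTop.geomToCO (Wm.map ψ₀) ((⇑φ ∘ Q) n) ∈ kernel (NormedField.valuation (K := CompletedAlgClosure (v'.adicCompletion K)))
          (curveOver (CompletedAlgClosure (v'.adicCompletion K)) (Wm.map ψ₀))),
        ‖((zPt (AinfTop.geomToCO (Wm.map ψ₀) ((⇑φ ∘ Q) 0)) (hker 0) : CBall (v'.adicCompletion K)) : CompletedAlgClosure (v'.adicCompletion K))‖ ^ N ≤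
            ‖(p : CompletedAlgClosure (v'.adicCompletion K))‖ →
        ∀ cP : v'.adicCompletion K,
          algebraMap (v'.adicCompletion K) (CompletedAlgClosure (v'.adicCompletion K)) cP =
            (p : CompletedAlgClosure (v'.adicCompletion K)) ^ N *
              ∑' j : ℕ, PowerSeries.coeff j (Wm.map ((CBall (v'.adicCompletion K)).subtype.comp (EisensteinRoot.CoeffDisc.toCBall D))).formalLog *
                ((zPt (AinfTop.geomToCO (Wm.map ψ₀) ((⇑φ ∘ Q) 0)) (hker 0) : CBall (v'.adicCompletion K)) : CompletedAlgClosure (v'.adicCompletion K)) ^ j →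
          ((tatePairingPoint W (v'.adicCompletion K) p eT hμ hadd₁ hadd₂ hgal hcompat (oneCocycleClass _ η) P : ℤ_[p]) : ℚ_[p]) =
            -Algebra.trace ℚ_[p] (v'.adicCompletion K) (cP * (expStarCoord W hp' d η * c))))
    (hP1 : exists_member_sl2ZetaElement_neron_values_bar) :
    Summit.BirchSwinnertonDyer.BirchSwinnertonDyer.Theses.EdixhovenFibreFiveSeven.StarredOptimalManinUnitFiveSeven := by
  refine StarredOptimalManinUnitFiveSevenOfOrdinaryLocalFormula.starredOptimalManinUnitFiveSeven_of_ordinaryLocalFormula ?_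
    StarredOptimalManinUnitFiveSevenDokchitserDokchitser.stub_dokchitserDokchitser hP1
  intro W' _ _ p _ hp57 hadd _hirr hIstar h4 h9 K _ _ α e htab hαe v' hv' _ _ _ hp' ω' _ _ eT hμ hadd₁ hadd₂ hgal hnondeg halt hcompat hinjK hdeK d''
  exact StarredOptimalManinUnitFiveSevenLocalFormulaOrdinaryCellsOfCapstone.localFormulaOrdinaryCells_of_capstone W' p hp57 hadd hIstar h4 h9 α htab hαe v'
    hv' hp' ω' eT hμ hadd₁ hadd₂ hgal hnondeg halt hcompat hinjK hdeK d''
    (hCAP W' p hp57 hadd hIstar h4 h9 α htab hαe v' hv' hp' ω' eT hμ hadd₁ hadd₂ hgal hnondeg halt hcompat hinjK hdeK d'')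

end Summit.BirchSwinnertonDyer.BirchSwinnertonDyer.Theorems.StarredOptimalManinUnitFiveSevenOfOrdinaryCapstone

end
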